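import Literature.Probability.Percolation.TriApproxDomainAssembly
import Literature.Probability.Percolation.TriCrossingSandwichMarked

/-!
# Route CardyBondTriangular · crux `BondTriangularCardy` (stmt-CriticalPhenomena-4664), line `birth`,
# stub `stub_discreteDomains`, part (D1): the model-free geometry of Bollobás–Riordan's Lemma 14

Helper of the stub `stub_discreteDomains` (`Sig.stub_discreteDomains`: Lemma 14 of
Bollobás–Riordan, *Percolation* (2006), Ch. 7, p. 184, with the boundary values of pp. 200–201 and
the sandwich (19)+(40), for the Chayes–Lei separating probabilities of critical bond percolation
on the triangular lattice). The construction of the two families of discrete domains `G_δ⁻`,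
`G_δ⁺` in the tree's proof of Lemma 14 for SITE percolation (`tri_exists_discreteApprox_proof`,
`TriApproxDomainAssembly.lean`) is model-free: marked inner approximations of the "longer,
thinner" and "shorter, fatter" collar domains of a conformal rectangle with anticlockwise
boundary, at a level `ε(δ) → 0` chosen diagonally (`exists_scale_tendsto`). Only its LAST clause,
the sandwich (19), refers to site percolation (through `level_m` / `level_p`).

This file re-assembles the construction WITHOUT the percolation clause and records instead the
pointwise geometric hypotheses under which the sandwich is proved for any model
(`TriMarkedDomain.IsLongerThinner`, `TriMarkedDomain.IsShorterFatter` of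
`TriCrossingSandwichMarked.lean`, Bollobás–Riordan's (28)–(29) p. 192), for EVERY corner radius
`ρ > 0` and precision `t > 0`, eventually as `δ → 0⁺`:

* `level_geometry` — at a fixed level `ε`, the marked inner approximation of the collar domain of
  sign pattern `σ` supplied by `level_core` has the level-`ε` approximation properties (arcs within
  `2ε`, fill of `Φ(B̄(0, 1 - 2ε))`, `2ε`-dense face centres) and satisfies (H1)–(H3) of
  `level_core` with corner radius `ε` and a tolerance `≤ ε`;
* `isLongerThinner_of_level` / `isShorterFatter_of_level` — for `σ = σm` (arcs `0`, `2` pushed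
  out), resp. `σ = σp`, these give `IsLongerThinner R G δ (2ε) ε`, resp. `IsShorterFatter R G δ (2ε) ε`;
* `discreteDomains_geometry` — the diagonal assembly: two discrete approximations
  (`IsDiscreteApprox`, verified exactly as in `tri_exists_discreteApprox_proof`, including the
  local connectivity of Claim 21 through `site_conn_collar` / `face_conn_collar`) which are
  eventually longer–thinner, resp. shorter–fatter, at every `(t, ρ)`.

This is the part of `Sig.discreteDomains` that does not depend on the percolation model; the
sandwich for the crude bond-`𝕋` crossing probability, (40) and the boundary values are the
remaining (percolation) parts of the stub.

References: B. Bollobás, O. Riordan, *Percolation*, CUP 2006, Ch. 7, Lemma 14 p. 184, (28)–(29)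
p. 192, Claim 21 p. 193, proof of Lemma 14 p. 195, (31)–(34) pp. 196–199.
-/

noncomputable section

namespace Summit.CriticalPhenomena.CardyFormulaZ2.Theorems.BondTriangularCardyLine

open Set Filter Topology Metric
open Literature.Probability.Percolation Literature.Probability.RandomPlanarGeometry
open Literature.Probability.LatticeModels

variable (R : ConformalRectangle) (T : R.toJordanDomain.TubeData)

/-- **The level-`ε` geometry of a collar approximation.** For a conformal rectangle `R` with
boundary of index `1`, tube data `T`, a sign pattern `σ` and a level `ε > 0`: a width `h ≤ ε` of
the collar domain `D_σ` (containing the centre) and `δ₀ > 0` such that for every `δ < δ₀` the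
marked inner approximation `G` of `D_σ` given by `level_core` (with corner radius `ε`, tolerance
cap `ε` and the arc–corner separation of `R`) has: arcs mutually within `2ε` of the arcs of `R`;
sites off `Ω` within `ε` of a pushed-out arc (`σ i = 1`); sites in `Ω` at distance `≥ ε` from the
corners farther than `δ` from the pulled-in arcs (`σ j = -1`); sites of pushed-out discrete arcs
at distance `≥ ε` from the corners off `Ω`; the mesh points of `Φ(B̄(0, 1 - 2ε))` are sites; face
centres `2ε`-dense in `closure Ω` (Bollobás–Riordan 2006, Ch. 7, (28)–(29) p. 192, (31)–(34)
pp. 196–199; a repackaging of `level_core`). -/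
theorem level_geometry {σ : Fin 4 → ℝ} (hσ1 : ∀ i, σ i = 1 ∨ σ i = -1)
    (hR1 : ∀ z ∈ R.carrier, R.index z = 1) {ε : ℝ} (hε : 0 < ε) :
    ∃ (h : ℝ) (hh : 0 < h) (hh1 : h ≤ 1 / 2), h ≤ ε ∧
      T.z₀ ∈ (R.collarRect T (MarkedDomain.abs_le_one_of_sign hσ1) hh hh1).carrier ∧
      ∃ δ₀ > 0, ∀ δ : ℝ, ∀ hδ : 0 < δ, δ < δ₀ →
        ∃ hc₀ : baseSite T.z₀ δ ∈ innerCoarse (R.collarRect T (MarkedDomain.abs_le_one_of_sign hσ1) hh hh1).carrier δ,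
        ∃ G : TriMarkedDomain 4,
          G.verts = (innerApprox (R.collarRect T (MarkedDomain.abs_le_one_of_sign hσ1) hh hh1).toJordanDomain hδ hc₀).verts ∧
          (∀ i : Fin 4, (∀ y ∈ G.arc i, ∃ z ∈ R.arc i, dist (triMeshPoint δ y) z < 2 * ε) ∧
            ∀ z ∈ R.arc i, ∃ y ∈ G.arc i, dist (triMeshPoint δ y) z < 2 * ε) ∧
          (∀ x ∈ G.verts, triMeshPoint δ x ∉ R.carrier → ∃ i, σ i = 1 ∧ infDist (triMeshPoint δ x) (R.arc i) ≤ ε) ∧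
          (∀ x ∈ G.verts, triMeshPoint δ x ∈ R.carrier → (∀ i, ε ≤ dist (triMeshPoint δ x) (R.pt i)) →
            ∀ j, σ j = -1 → δ < infDist (triMeshPoint δ x) (R.arc j)) ∧
          (∀ i, σ i = 1 → ∀ u ∈ G.arc i, (∀ k, ε ≤ dist (triMeshPoint δ u) (R.pt k)) →
            triMeshPoint δ u ∉ R.carrier) ∧
          (∀ x : Site 2, triMeshPoint δ x ∈ T.Ci.Φ '' closedBall (0 : ℂ) (1 - 2 * ε) → x ∈ G.verts) ∧
          (∀ z ∈ closure R.carrier, ∃ w ∈ G.faces, dist z ((δ : ℂ) * hexCenter w) < 2 * ε) := by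
  classical
  obtain ⟨carc, hcarc0, hcarc⟩ := R.exists_pos_le_infDist_pt_arc
  obtain ⟨h, hh, hh1, hhε, hz₀, δ₀, hδ₀, t, ht0, htε, hlev⟩ := level_core R T hσ1 hR1 hε hε hε hcarc
  refine ⟨h, hh, hh1, hhε, hz₀, δ₀, hδ₀, fun δ hδ hδlt => ?_⟩
  obtain ⟨hc₀, G, hGv, harcs, H1, H2, H3, -, hfill, hdense⟩ := hlev δ hδ hδlt
  refine ⟨hc₀, G, hGv, harcs, fun x hx hxΩ => ?_, fun x hx hxΩ hfar j hσj => H2 x hx hxΩ hfar j hσj,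
    fun i hσi u hu hfar => (H3 i hσi u hu hfar).1, hfill, hdense⟩
  obtain ⟨i, hσi, hd⟩ := H1 x hx hxΩ
  exact ⟨i, hσi, hd.trans htε⟩

/-- An arc site of a level-`ε` approximation is within `2ε` of the corresponding arc of `R`
(from the mutual `2ε`-closeness of the arcs). -/
theorem infDist_arc_le_of_arcs_close {G : TriMarkedDomain 4} {δ ε : ℝ} {i : Fin 4}
    (harcs : ∀ y ∈ G.arc i, ∃ z ∈ R.arc i, dist (triMeshPoint δ y) z < 2 * ε) {u : Site 2}
    (hu : u ∈ G.arc i) : infDist (triMeshPoint δ u) (R.arc i) ≤ 2 * ε := by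
  obtain ⟨z, hz, hd⟩ := harcs u hu
  exact (infDist_le_dist_of_mem hz).trans hd.le

/-- **The "longer, thinner" pattern `σm` gives `IsLongerThinner` at precision `2ε` and corner
radius `ε`.** If the sites of `G` off `Ω` are within `ε` of an arc `i` with `σm i = 1` (i.e.
`i = 0` or `i = 2`), the sites in `Ω` at distance `≥ ε` from the corners are farther than `δ`
from the arcs `j` with `σm j = -1` (`j = 1, 3`), the far sites of the discrete arcs `0`, `2` are
off `Ω`, and every site of the `i`-th discrete arc is within `2ε` of `Aᵢ`, then
`G.IsLongerThinner R δ (2ε) ε` (Bollobás–Riordan 2006, Ch. 7, (28)–(29) p. 192 for `G_δ⁻`). -/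
theorem isLongerThinner_of_level {G : TriMarkedDomain 4} {δ ε : ℝ} (hε : 0 < ε)
    (harcs : ∀ i : Fin 4, ∀ y ∈ G.arc i, ∃ z ∈ R.arc i, dist (triMeshPoint δ y) z < 2 * ε)
    (H1 : ∀ x ∈ G.verts, triMeshPoint δ x ∉ R.carrier → ∃ i, σm i = 1 ∧ infDist (triMeshPoint δ x) (R.arc i) ≤ ε)
    (H2 : ∀ x ∈ G.verts, triMeshPoint δ x ∈ R.carrier → (∀ i, ε ≤ dist (triMeshPoint δ x) (R.pt i)) →
      ∀ j, σm j = -1 → δ < infDist (triMeshPoint δ x) (R.arc j))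
    (H3 : ∀ i, σm i = 1 → ∀ u ∈ G.arc i, (∀ k, ε ≤ dist (triMeshPoint δ u) (R.pt k)) →
      triMeshPoint δ u ∉ R.carrier) :
    G.IsLongerThinner R δ (2 * ε) ε where
  far_out x hx _ hout := by
    obtain ⟨i, hσi, hd⟩ := H1 x hx hout
    rcases σm_eq_one_iff.1 hσi with rfl | rfl
    · exact Or.inl (by linarith)
    · exact Or.inr (by linarith)
  far_in x hx hfar hin := ⟨H2 x hx hin hfar 1 (by simp [σm]), H2 x hx hin hfar 3 (by simp [σm])⟩
  arc_zero u hu := ⟨infDist_arc_le_of_arcs_close R (harcs 0) hu, fun hfar => H3 0 (by simp [σm]) u hu hfar⟩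
  arc_two v hv := ⟨infDist_arc_le_of_arcs_close R (harcs 2) hv, fun hfar => H3 2 (by simp [σm]) v hv hfar⟩

/-- **The "shorter, fatter" pattern `σp` gives `IsShorterFatter` at precision `2ε` and corner
radius `ε`** (the same with the pairs of arcs exchanged: `σp i = 1` iff `i = 1` or `i = 3`;
Bollobás–Riordan 2006, Ch. 7, p. 192 for `G_δ⁺`). -/
theorem isShorterFatter_of_level {G : TriMarkedDomain 4} {δ ε : ℝ} (hε : 0 < ε)
    (harcs : ∀ i : Fin 4, ∀ y ∈ G.arc i, ∃ z ∈ R.arc i, dist (triMeshPoint δ y) z < 2 * ε)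
    (H1 : ∀ x ∈ G.verts, triMeshPoint δ x ∉ R.carrier → ∃ i, σp i = 1 ∧ infDist (triMeshPoint δ x) (R.arc i) ≤ ε)
    (H2 : ∀ x ∈ G.verts, triMeshPoint δ x ∈ R.carrier → (∀ i, ε ≤ dist (triMeshPoint δ x) (R.pt i)) →
      ∀ j, σp j = -1 → δ < infDist (triMeshPoint δ x) (R.arc j))
    (H3 : ∀ i, σp i = 1 → ∀ u ∈ G.arc i, (∀ k, ε ≤ dist (triMeshPoint δ u) (R.pt k)) →
      triMeshPoint δ u ∉ R.carrier) :
    G.IsShorterFatter R δ (2 * ε) ε where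
  far_out x hx _ hout := by
    obtain ⟨i, hσi, hd⟩ := H1 x hx hout
    rcases σp_eq_one_iff.1 hσi with rfl | rfl
    · exact Or.inl (by linarith)
    · exact Or.inr (by linarith)
  far_in x hx hfar hin := ⟨H2 x hx hin hfar 0 (by simp [σp]), H2 x hx hin hfar 2 (by simp [σp])⟩
  arc_one u hu := ⟨infDist_arc_le_of_arcs_close R (harcs 1) hu, fun hfar => H3 1 (by simp [σp]) u hu hfar⟩
  arc_three v hv := ⟨infDist_arc_le_of_arcs_close R (harcs 3) hv, fun hfar => H3 3 (by simp [σp]) v hv hfar⟩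

/-- **A family of marked domains which is eventually level-`e(δ)` with `e → 0` is a discrete
approximation** (the `IsDiscreteApprox` verification of `tri_exists_discreteApprox_proof`,
Bollobás–Riordan 2006, Ch. 7, (18), (31)–(34), Claim 21): arcs `2e(δ)`-close, face centres
`2e(δ)`-dense, compacta `K ⊆ Ω` eventually filled (`K ⊆ Φ(B̄(0, r))`, `r < 1`), and the local
connectivity clauses at the scales `1/(k+1) < γ`. -/
theorem isDiscreteApprox_of_levelProp {η θ : ℕ → ℝ} (hη : ∀ k, 0 < η k) (hθ0 : ∀ k, 0 < θ k)
    {e : ℝ → ℝ} (he : Tendsto e (𝓝[>] 0) (𝓝 0)) (G : ℝ → TriMarkedDomain 4)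
    (hG : ∀ᶠ δ in 𝓝[>] (0 : ℝ), LevelProp R T η θ (e δ) δ (G δ)) : IsDiscreteApprox R G := by
  have he2 : Tendsto (fun δ => 2 * e δ) (𝓝[>] 0) (𝓝 0) := by simpa using he.const_mul 2
  have hsmall : ∀ c > 0, ∀ᶠ δ in 𝓝[>] (0 : ℝ), e δ < c := fun c hc => he (Iio_mem_nhds hc)
  refine ⟨⟨fun δ => 2 * e δ, he2, hG.mono fun δ hδ i => ⟨fun z hz => ?_, fun y hy => ?_⟩⟩,
    ⟨fun δ => 2 * e δ, he2, hG.mono fun δ hδ z hz => ?_⟩, fun K hK hKΩ => ?_, fun γ hγ => ?_, fun γ hγ => ?_⟩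
  · obtain ⟨y, hy, hd⟩ := (hδ.arcs i).2 z hz
    exact ⟨_, ⟨y, hy, rfl⟩, by rw [dist_comm]; exact hd.le⟩
  · obtain ⟨y', hy', rfl⟩ := hy
    obtain ⟨z, hz, hd⟩ := (hδ.arcs i).1 y' hy'
    exact ⟨z, hz, hd.le⟩
  · obtain ⟨w, hw, hd⟩ := hδ.dense z hz
    exact ⟨w, hw, hd.le⟩
  · -- fill: `K ⊆ Φ(B̄(0, r))` for some `r < 1`
    have hKc : IsCompact (T.Ci.φ.symm '' K) := hK.image_of_continuousOn (T.Ci.φ.symm.continuousOn.mono hKΩ)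
    have hKball : T.Ci.φ.symm '' K ⊆ ball (0 : ℂ) 1 := by
      rintro _ ⟨x, hx, rfl⟩
      have := T.Ci.φ.symm.toPartialEquiv.map_source (x := x) (by rw [T.Ci.φ.symm.source_eq]; exact hKΩ hx)
      rwa [T.Ci.φ.symm.target_eq] at this
    obtain ⟨r, hr1, hKr⟩ : ∃ r < 1, ∀ u ∈ T.Ci.φ.symm '' K, ‖u‖ ≤ r := by
      rcases (T.Ci.φ.symm '' K).eq_empty_or_nonempty with h0 | hne
      · exact ⟨0, one_pos, by rw [h0]; simp⟩
      · obtain ⟨u₀, hu₀, hmax⟩ := hKc.exists_isMaxOn hne continuous_norm.continuousOn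
        exact ⟨‖u₀‖, mem_ball_zero_iff.1 (hKball hu₀), fun u hu => hmax hu⟩
    filter_upwards [hG, hsmall ((1 - r) / 2) (by linarith)] with δ hδ hδs x hx
    refine hδ.fill x ⟨T.Ci.φ.symm (triMeshPoint δ x), mem_closedBall_zero_iff.2 ?_, ?_⟩
    · linarith [hKr _ ⟨_, hx, rfl⟩]
    · have hxΩ := hKΩ hx
      rw [T.Ci.eqOn (hKball ⟨_, hx, rfl⟩)]
      exact T.Ci.φ.apply_symm_apply hxΩ
  · -- site connectivity
    obtain ⟨k, hk⟩ := exists_nat_one_div_lt hγ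
    refine ⟨η k, hη k, ?_⟩
    filter_upwards [hG, hsmall (θ k) (hθ0 k)] with δ hδ hδs x hx y hy hxy
    exact (hδ.conn k hδs.le).1 x hx y hy hxy |>.mono (inter_subset_inter_right _ fun v (hv : _ < _) => hv.trans hk)
  · -- local connectivity of faces
    obtain ⟨k, hk⟩ := exists_nat_one_div_lt hγ
    refine ⟨η k, hη k, ?_⟩
    filter_upwards [hG, hsmall (θ k) (hθ0 k)] with δ hδ hδs w hw z hz hwz
    have hpath := (hδ.conn k hδs.le).2 w hw z hz hwz
    have hp : (fun F F' : HexVertex => hexGraph.Adj F F' ∧ F' ∈ (G δ).faces ∧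
        dist ((δ : ℂ) * hexCenter w) ((δ : ℂ) * hexCenter F') < 2 * (1 / ((k : ℝ) + 1))) ≤
        (fun F F' : HexVertex => hexGraph.Adj F F' ∧ F' ∈ (G δ).faces ∧ dist ((δ : ℂ) * hexCenter w) ((δ : ℂ) * hexCenter F') < 2 * γ) :=
      fun F F' hFF' => ⟨hFF'.1, hFF'.2.1, by linarith [hFF'.2.2]⟩
    exact Relation.ReflTransGen.mono hp w z hpath

/-- **(D1) The model-free geometry of Lemma 14 for an anticlockwise Carleson datum.** For a
conformal rectangle `R` with a Carleson datum `(a, b, c, d, ψ)` whose triangle is anticlockwise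
(`triangleTurn a b c = ω`), there are two families of 4-marked discrete domains `G_δ⁻`, `G_δ⁺` of
`𝕋`, placed in `δ𝕋`, which are discrete approximations of `R` (`IsDiscreteApprox`: arcs
`o(1)`-close, dense triangles, filled compacta, local connectivity of sites and triangles) and
which, for every corner radius `ρ > 0` and precision `t > 0`, are eventually (as `δ → 0⁺`)
longer–thinner, resp. shorter–fatter, than `R` at `(t, ρ)` in the sense of
`TriMarkedDomain.IsLongerThinner` / `TriMarkedDomain.IsShorterFatter`: far sites off `Ω` hug
`A₀ ∪ A₂` (resp. `A₁ ∪ A₃`) within `t`, far sites in `Ω` keep off the two other arcs by more than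
a mesh, and the pushed-out discrete arcs are within `t` of their arcs and off `Ω` away from the
corners. This is Bollobás–Riordan's construction (Percolation, CUP 2006, Ch. 7, Lemma 14 p. 184,
(28)–(29) p. 192, Claim 21 p. 193, p. 195, (31)–(34) pp. 196–199) — the marked inner
approximations of the collar domains at a diagonally chosen level `ε(δ) → 0` — with the
percolation clause (19) replaced by the pointwise hypotheses from which (19) is proved for any
model; it is the part of `Sig.discreteDomains` (stub `stub_discreteDomains` of crux
stmt-CriticalPhenomena-4664, line `birth`) that does not depend on the percolation model. -/
theorem discreteDomains_geometry :
    ∀ (R : Literature.Probability.RandomPlanarGeometry.ConformalRectangle) (a b c d : ℂ)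
      (ψ : Literature.Probability.RandomPlanarGeometry.ConformalEquiv R.carrier (Literature.Probability.Percolation.openTriangle a b c)),
      Literature.Probability.Percolation.IsEquilateral a b c → d ∈ openSegment ℝ c a →
      Literature.Probability.Percolation.IsCarlesonMap R a b c d ψ →
      Literature.Probability.Percolation.triangleTurn a b c = Literature.Probability.Percolation.triOmega →
      ∃ Gm Gp : ℝ → Literature.Probability.Percolation.TriMarkedDomain 4,
        Literature.Probability.Percolation.IsDiscreteApprox R Gm ∧ Literature.Probability.Percolation.IsDiscreteApprox R Gp ∧
        (∀ ρ > (0 : ℝ), ∀ t > (0 : ℝ), ∀ᶠ δ : ℝ in nhdsWithin (0 : ℝ) (Set.Ioi 0), (Gm δ).IsLongerThinner R δ t ρ) ∧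
        (∀ ρ > (0 : ℝ), ∀ t > (0 : ℝ), ∀ᶠ δ : ℝ in nhdsWithin (0 : ℝ) (Set.Ioi 0), (Gp δ).IsShorterFatter R δ t ρ) := by
  classical
  intro R a b c d ψ habc hd hψ hturn
  have hR1 : ∀ z ∈ R.carrier, R.index z = 1 := fun z hz => index_eq_one_of_isCarlesonMap R ψ habc hψ hturn hz
  obtain ⟨T⟩ := R.toJordanDomain.nonempty_tubeData
  -- local connectivity data at the scales `γ_k = 1/(k+1)` (Claim 21, uniform in the level)
  have hc : ∀ γ > (0 : ℝ), ∃ η > (0 : ℝ), ∃ ε₁ > (0 : ℝ), ∀ (σ : Fin 4 → ℝ) (hσ1 : ∀ i, σ i = 1 ∨ σ i = -1) (h : ℝ) (hh : 0 < h)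
      (hh1 : h ≤ 1 / 2), h ≤ ε₁ → T.z₀ ∈ (R.collarRect T (MarkedDomain.abs_le_one_of_sign hσ1) hh hh1).carrier →
      ∃ δ₁ > (0 : ℝ), ∀ (δ : ℝ) (hδ : 0 < δ)
        (hc₀ : baseSite T.z₀ δ ∈ innerCoarse (R.collarRect T (MarkedDomain.abs_le_one_of_sign hσ1) hh hh1).carrier δ), δ < δ₁ →
        (∀ x ∈ (innerApprox (R.collarRect T (MarkedDomain.abs_le_one_of_sign hσ1) hh hh1).toJordanDomain hδ hc₀).verts,
          ∀ y ∈ (innerApprox (R.collarRect T (MarkedDomain.abs_le_one_of_sign hσ1) hh hh1).toJordanDomain hδ hc₀).verts,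
            dist (triMeshPoint δ x) (triMeshPoint δ y) < η →
            PathIn triGraph (((innerApprox (R.collarRect T (MarkedDomain.abs_le_one_of_sign hσ1) hh hh1).toJordanDomain hδ hc₀).verts :
              Set (Site 2)) ∩ {v | dist (triMeshPoint δ x) (triMeshPoint δ v) < γ}) x y) ∧
        (∀ w ∈ triFacesIn (innerApprox (R.collarRect T (MarkedDomain.abs_le_one_of_sign hσ1) hh hh1).toJordanDomain hδ hc₀).verts,
          ∀ z ∈ triFacesIn (innerApprox (R.collarRect T (MarkedDomain.abs_le_one_of_sign hσ1) hh hh1).toJordanDomain hδ hc₀).verts,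
            dist ((δ : ℂ) * hexCenter w) ((δ : ℂ) * hexCenter z) < η →
            Relation.ReflTransGen (fun F F' : HexVertex => hexGraph.Adj F F' ∧
              F' ∈ triFacesIn (innerApprox (R.collarRect T (MarkedDomain.abs_le_one_of_sign hσ1) hh hh1).toJordanDomain hδ hc₀).verts ∧
              dist ((δ : ℂ) * hexCenter w) ((δ : ℂ) * hexCenter F') < 2 * γ) w z) := by
    intro γ hγ
    obtain ⟨ηs, hηs, hsite⟩ := site_conn_collar R T hγ
    obtain ⟨ηf, hηf, hface⟩ := face_conn_collar R T hγ
    refine ⟨min ηs ηf, lt_min hηs hηf, 1, one_pos, fun σ hσ1 h hh hh1 _ _ => ⟨min ηs ηf, lt_min hηs hηf, fun δ hδ hc₀ hδlt => ⟨?_, ?_⟩⟩⟩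
    · intro x hx y hy hxy
      exact hsite σ _ h hh hh1 δ hδ hc₀ (hδlt.trans_le (min_le_left _ _)) x hx y hy (hxy.trans_le (min_le_left _ _))
    · intro w hw z hz hwz
      exact hface σ _ h hh hh1 δ hδ hc₀ (hδlt.trans_le (min_le_right _ _)) w hw z hz (hwz.trans_le (min_le_right _ _))
  choose η hη ε₁ hε₁ hck using fun k : ℕ => hc (1 / ((k : ℝ) + 1)) (by positivity)
  set θ : ℕ → ℝ := fun k => min (ε₁ k) (1 / ((k : ℝ) + 1)) with hθ
  have hθ0 : ∀ k, 0 < θ k := fun k => lt_min (hε₁ k) (by positivity)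
  -- the per-level predicate: level-`ε` approximation properties and the level-`ε` geometry
  set P : ℝ → ℝ → Prop := fun ε δ => ∃ Gm Gp : TriMarkedDomain 4,
    (LevelProp R T η θ ε δ Gm ∧ Gm.IsLongerThinner R δ (2 * ε) ε) ∧
    (LevelProp R T η θ ε δ Gp ∧ Gp.IsShorterFatter R δ (2 * ε) ε) with hP
  have hPall : ∀ ε > 0, ∃ δ₀ > 0, ∀ δ, 0 < δ → δ < δ₀ → P ε δ := by
    intro ε hε
    obtain ⟨hm, hhm, hhm1, hmε, hz₀m, δm, hδm, hlevm⟩ := level_geometry R T σm_sign hR1 hε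
    obtain ⟨hp, hhp, hhp1, hpε, hz₀p, δp, hδp, hlevp⟩ := level_geometry R T σp_sign hR1 hε
    -- connectivity thresholds for the finitely many relevant `k`
    have hkN : ∀ k : ℕ, ε ≤ θ k → k < ⌈1 / ε⌉₊ + 1 := by
      intro k hk
      have h1 : ε ≤ 1 / ((k : ℝ) + 1) := hk.trans (min_le_right _ _)
      have h2 : (k : ℝ) + 1 ≤ 1 / ε := by
        rw [le_div_iff₀ hε]; rw [le_div_iff₀ (by positivity)] at h1; linarith
      have h3 : (k : ℝ) < ⌈1 / ε⌉₊ + 1 := by linarith [Nat.le_ceil (1 / ε)]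
      exact_mod_cast h3
    have hdm : ∀ k, ∃ d > (0 : ℝ), ε ≤ θ k → ∀ (δ : ℝ) (hδ : 0 < δ)
        (hc₀ : baseSite T.z₀ δ ∈ innerCoarse (R.collarRect T (MarkedDomain.abs_le_one_of_sign σm_sign) hhm hhm1).carrier δ), δ < d → _ :=
      fun k => by
        by_cases hk : ε ≤ θ k
        · obtain ⟨δ₁, hδ₁, h⟩ := hck k σm σm_sign hm hhm hhm1 (hmε.trans (hk.trans (min_le_left _ _))) hz₀m
          exact ⟨δ₁, hδ₁, fun _ => h⟩
        · exact ⟨1, one_pos, fun h => absurd h hk⟩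
    choose dm hdm0 hdmk using hdm
    have hdp : ∀ k, ∃ d > (0 : ℝ), ε ≤ θ k → ∀ (δ : ℝ) (hδ : 0 < δ)
        (hc₀ : baseSite T.z₀ δ ∈ innerCoarse (R.collarRect T (MarkedDomain.abs_le_one_of_sign σp_sign) hhp hhp1).carrier δ), δ < d → _ :=
      fun k => by
        by_cases hk : ε ≤ θ k
        · obtain ⟨δ₁, hδ₁, h⟩ := hck k σp σp_sign hp hhp hhp1 (hpε.trans (hk.trans (min_le_left _ _))) hz₀p
          exact ⟨δ₁, hδ₁, fun _ => h⟩
        · exact ⟨1, one_pos, fun h => absurd h hk⟩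
    choose dp hdp0 hdpk using hdp
    obtain ⟨Dm, hDm, hDmk⟩ := exists_pos_le_forall_lt hdm0 (⌈1 / ε⌉₊ + 1)
    obtain ⟨Dp, hDp, hDpk⟩ := exists_pos_le_forall_lt hdp0 (⌈1 / ε⌉₊ + 1)
    refine ⟨min (min δm δp) (min Dm Dp), by positivity, fun δ hδ hδlt => ?_⟩
    have hδm' : δ < δm := hδlt.trans_le ((min_le_left _ _).trans (min_le_left _ _))
    have hδp' : δ < δp := hδlt.trans_le ((min_le_left _ _).trans (min_le_right _ _))
    have hδDm : δ < Dm := hδlt.trans_le ((min_le_right _ _).trans (min_le_left _ _))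
    have hδDp : δ < Dp := hδlt.trans_le ((min_le_right _ _).trans (min_le_right _ _))
    obtain ⟨hc₀m, Gm, hGmv, harcm, H1m, H2m, H3m, hfillm, hdensem⟩ := hlevm δ hδ hδm'
    obtain ⟨hc₀p, Gp, hGpv, harcp, H1p, H2p, H3p, hfillp, hdensep⟩ := hlevp δ hδ hδp'
    refine ⟨Gm, Gp, ⟨⟨harcm, hfillm, hdensem, fun k hk => ?_⟩,
        isLongerThinner_of_level R hε (fun i => (harcm i).1) H1m H2m H3m⟩,
      ⟨⟨harcp, hfillp, hdensep, fun k hk => ?_⟩, isShorterFatter_of_level R hε (fun i => (harcp i).1) H1p H2p H3p⟩⟩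
    · have := hdmk k hk δ hδ hc₀m ((hδDm.trans_le (hDmk k (hkN k hk))))
      rw [← hGmv] at this
      exact this
    · have := hdpk k hk δ hδ hc₀p ((hδDp.trans_le (hDpk k (hkN k hk))))
      rw [← hGpv] at this
      exact this
  obtain ⟨e, he, hepos, heP⟩ := exists_scale_tendsto hPall
  -- the families
  obtain ⟨δs, hδs⟩ := heP.exists
  set G₀ : TriMarkedDomain 4 := hδs.choose with hG₀
  set Gm : ℝ → TriMarkedDomain 4 := fun δ => if hPδ : P (e δ) δ then hPδ.choose else G₀ with hGm
  set Gp : ℝ → TriMarkedDomain 4 := fun δ => if hPδ : P (e δ) δ then hPδ.choose_spec.choose else G₀ with hGp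
  have hspec : ∀ δ, P (e δ) δ →
      (LevelProp R T η θ (e δ) δ (Gm δ) ∧ (Gm δ).IsLongerThinner R δ (2 * e δ) (e δ)) ∧
      (LevelProp R T η θ (e δ) δ (Gp δ) ∧ (Gp δ).IsShorterFatter R δ (2 * e δ) (e δ)) := by
    intro δ hPδ
    have h1 : Gm δ = hPδ.choose := by simp only [hGm, dif_pos hPδ]
    have h2 : Gp δ = hPδ.choose_spec.choose := by simp only [hGp, dif_pos hPδ]
    rw [h1, h2]
    exact hPδ.choose_spec.choose_spec
  -- eventual smallness of `e`
  have hsmall : ∀ c > 0, ∀ᶠ δ in 𝓝[>] (0 : ℝ), e δ < c := fun c hc => he (Iio_mem_nhds hc)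
  refine ⟨Gm, Gp, isDiscreteApprox_of_levelProp R T hη hθ0 he Gm (heP.mono fun δ hδ => (hspec δ hδ).1.1),
    isDiscreteApprox_of_levelProp R T hη hθ0 he Gp (heP.mono fun δ hδ => (hspec δ hδ).2.1),
    fun ρ hρ t ht => ?_, fun ρ hρ t ht => ?_⟩
  · filter_upwards [heP, hsmall (min ρ (t / 2)) (by positivity)] with δ hδ hδs
    have h1 : e δ < ρ := hδs.trans_le (min_le_left _ _)
    have h2 : e δ < t / 2 := hδs.trans_le (min_le_right _ _)
    exact (hspec δ hδ).1.2.mono (by linarith) h1.le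
  · filter_upwards [heP, hsmall (min ρ (t / 2)) (by positivity)] with δ hδ hδs
    have h1 : e δ < ρ := hδs.trans_le (min_le_left _ _)
    have h2 : e δ < t / 2 := hδs.trans_le (min_le_right _ _)
    exact (hspec δ hδ).2.2.mono (by linarith) h1.le

end Summit.CriticalPhenomena.CardyFormulaZ2.Theorems.BondTriangularCardyLine

end
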